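import Summits.ResolutionOfSingularities.ResolutionOfSingularities.Theorems.WildQuotientsWildQuotientResolutionToricChartLemmas
import HarnessLib

/-!
# (T-I3b) (B-L)(i-b): THE BINOMIAL PRESENTATION OF `𝔸¹ × node` — `k[X₀,…,X₄]/(X₀X₁ − X₂X₃) ≅ ToricChart.Ring k PEmpty D_seg`
# (crux `FInjectiveMacaulayfication` stmt-ResolutionOfSingularities-15315, chain w45a, door v41.1; res-L1-w45a-plan-1 RULING R23.7 (B-L)(i); seat res-L1-w45a-lead-1 g12)

[OURS · L1 W4.5a] Support file (`--supports stmt-ResolutionOfSingularities-15315 --as helper`); replaces the role of NO printed item; NOT a statement of any manuscript;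
def-free; UNCONDITIONAL; no named fact. AI-written (AI review is weaker than expert review). Nothing of the crux is proved here.

`D_seg : ConeDatum 4 3 := ⟨![1,1,0,0], ![![0,1,1,0],![0,1,0,1],![0,1,1,1]]⟩` (binder form) presents `k[t, x, xy, xz, xyz] ⊂ k[t,x,y,z]` (`y, z` dummies), i.e. `𝔸¹ × (cone
over the unit square) = 𝔸¹ × node`; it is the target of the three `𝔸¹ × node` Rees charts of `Bl_{Sing_red} U_R` (`…RMonoidNodeCharts`). THIS FILE computes its toric ideal:
★ `nonempty_ringEquiv_binomial` — `k[X₀,…,X₄]/(X₀X₁ − X₂X₃) ≃+* Ring k PEmpty D_seg` (`X₀ ↦ x`, `X₁ ↦ xyz`, `X₂ ↦ xy`, `X₃ ↦ xz`, `X₄ ↦ t`), the shape consumed by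
✓ `SegreConeFull.clause_xy_sub_zw` (FULL clause at every closed point, every prime `p`). PROOF: the substitution `χ` (variables to symbols) descends to
`Φ : k[X]/(g) → Ring` (`g ↦ Y_x Y_{xyz} − Y_{xy} Y_{xz} ∈ ker presentation`), is surjective (symbols generate; dummies are `1`), and injective: if `ψ F = 0` for
`ψ = presentation ∘ χ : X₀ ↦ x, X₁ ↦ xyz, X₂ ↦ xy, X₃ ↦ xz, X₄ ↦ t`, divide `F` by `g` for the lexicographic monomial order (`MonomialOrder.div_single`; leading monomial `X₀X₁`):
the remainder `r` has no monomial divisible by `X₀X₁`, and `ψ` maps such monomials to DISTINCT monomials (`expMap_injOn`), so `ψ r = 0 ⇒ r = 0 ⇒ F ∈ (g)`.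
[folklore; cite: CoxLittleSchenck2011, Ex. 1.1.6 / Prop. 1.1.9 (toric ideals are binomial; the Segre cone); StacksProject, Tag 052Q (context)]
-/

-- single-problem summit: the doubled namespace component is forced
set_option linter.dupNamespace false

noncomputable section

namespace Summit.ResolutionOfSingularities.ResolutionOfSingularities.Theorems.FInjectiveMacaulayfication.SegreNodeBinomial

open MvPolynomial
open Summit.ResolutionOfSingularities.ResolutionOfSingularities.Theorems.WildQuotientResolution
open Summit.ResolutionOfSingularities.ResolutionOfSingularities.Theorems.WildQuotientResolution.ToricChart

variable (k : Type) [Field k]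

/-! ## §1 The exponent map of `ψ : X₀ ↦ x, X₁ ↦ xyz, X₂ ↦ xy, X₃ ↦ xz, X₄ ↦ t` and its injectivity on `X₀X₁`-free monomials -/

/-- The `(t,x,y,z)`-exponent (as a finsupp on `Fin 4 ⊕ PEmpty`) of `ψ(X^c)`: `t ↦ c₄`, `x ↦ c₀+c₁+c₂+c₃`, `y ↦ c₁+c₂`, `z ↦ c₁+c₃`. Written as a sum of singles so that it is
manifestly additive. [OURS] -/
theorem expMap_apply (c : Fin 5 →₀ ℕ) (i : Fin 4) :
    (c 4 • Finsupp.single (Sum.inl 0 : Fin 4 ⊕ PEmpty) 1 + (c 0 + c 1 + c 2 + c 3) • Finsupp.single (Sum.inl 1) 1 +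
        (c 1 + c 2) • Finsupp.single (Sum.inl 2) 1 + (c 1 + c 3) • Finsupp.single (Sum.inl 3) 1 : (Fin 4 ⊕ PEmpty) →₀ ℕ) (Sum.inl i) =
      ![c 4, c 0 + c 1 + c 2 + c 3, c 1 + c 2, c 1 + c 3] i := by
  fin_cases i <;> simp

/-- ★ `ψ` separates the monomials not divisible by `X₀X₁`: the exponent map is injective on `{c | c₀ = 0 ∨ c₁ = 0}`. [OURS] -/
theorem expMap_injOn (c c' : Fin 5 →₀ ℕ) (hc : c 0 = 0 ∨ c 1 = 0) (hc' : c' 0 = 0 ∨ c' 1 = 0)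
    (h : (c 4 • Finsupp.single (Sum.inl 0 : Fin 4 ⊕ PEmpty) 1 + (c 0 + c 1 + c 2 + c 3) • Finsupp.single (Sum.inl 1) 1 +
        (c 1 + c 2) • Finsupp.single (Sum.inl 2) 1 + (c 1 + c 3) • Finsupp.single (Sum.inl 3) 1 : (Fin 4 ⊕ PEmpty) →₀ ℕ) =
      c' 4 • Finsupp.single (Sum.inl 0) 1 + (c' 0 + c' 1 + c' 2 + c' 3) • Finsupp.single (Sum.inl 1) 1 +
        (c' 1 + c' 2) • Finsupp.single (Sum.inl 2) 1 + (c' 1 + c' 3) • Finsupp.single (Sum.inl 3) 1) : c = c' := by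
  have e := fun i : Fin 4 => (expMap_apply c i).symm.trans ((DFunLike.congr_fun h (Sum.inl i)).trans (expMap_apply c' i))
  have e0 := e 0; have e1 := e 1; have e2 := e 2; have e3 := e 3
  simp only [Matrix.cons_val_zero, Matrix.cons_val_one, Matrix.cons_val] at e0 e1 e2 e3
  ext i
  fin_cases i <;> simp only [Fin.zero_eta, Fin.mk_one, Fin.reduceFinMk, Fin.isValue] <;> omega

/-! ## §2 The binomial presentation (binder form in `D_seg`) -/

/-- ★ **`k[X₀,…,X₄]/(X₀X₁ − X₂X₃) ≅ Ring k PEmpty D_seg = k[t, x, xy, xz, xyz]`** (`X₀ ↦ x`, `X₁ ↦ xyz`, `X₂ ↦ xy`, `X₃ ↦ xz`, `X₄ ↦ t`): the toric ideal of `𝔸¹ × node` is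
the principal binomial ideal `(X₀X₁ − X₂X₃)`. [folklore; cite: CoxLittleSchenck2011, Ex. 1.1.6] -/
theorem nonempty_ringEquiv_binomial (D' : ConeDatum 4 3) (hD' : D' = ⟨![1, 1, 0, 0], ![![0, 1, 1, 0], ![0, 1, 0, 1], ![0, 1, 1, 1]]⟩)
    (g : MvPolynomial (Fin 5) k) (hg : g = X 0 * X 1 - X 2 * X 3) :
    Nonempty ((MvPolynomial (Fin 5) k ⧸ Ideal.span {g}) ≃+* Ring k PEmpty D') := by
  classical
  subst hD'
  -- the substitution `χ : X_i ↦ symbols`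
  let sym : Fin 5 → (Fin 4 ⊕ PEmpty) ⊕ Fin 3 := ![Sum.inl (Sum.inl 1), Sum.inr 2, Sum.inr 0, Sum.inr 1, Sum.inl (Sum.inl 0)]
  let χ : MvPolynomial (Fin 5) k →ₐ[k] MvPolynomial ((Fin 4 ⊕ PEmpty) ⊕ Fin 3) k := aeval fun i => X (sym i)
  have hχX : ∀ i, χ (X i) = X (sym i) := fun i => aeval_X _ i
  set D' : ConeDatum 4 3 := ⟨![1, 1, 0, 0], ![![0, 1, 1, 0], ![0, 1, 0, 1], ![0, 1, 1, 1]]⟩ with hD'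
  let pres := presentation k PEmpty D'
  -- `ψ = pres ∘ χ` on variables: monomials
  let ex : Fin 5 → (Fin 4 ⊕ PEmpty) →₀ ℕ := ![Finsupp.single (Sum.inl 1) 1,
    Finsupp.single (Sum.inl 1) 1 + Finsupp.single (Sum.inl 2) 1 + Finsupp.single (Sum.inl 3) 1,
    Finsupp.single (Sum.inl 1) 1 + Finsupp.single (Sum.inl 2) 1, Finsupp.single (Sum.inl 1) 1 + Finsupp.single (Sum.inl 3) 1, Finsupp.single (Sum.inl 0) 1]
  have hψX : ∀ i, pres (χ (X i)) = monomial (ex i) 1 := by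
    intro i
    rw [hχX]
    fin_cases i
    · change pres (X (Sum.inl (Sum.inl 1))) = _
      rw [presentation_X_inl_inl]; simp [ex, D']; rfl
    · change pres (X (Sum.inr 2)) = _
      rw [presentation_X_inr]; simp [ex, D', xmon, Fin.prod_univ_four, X, monomial_mul, monomial_pow]
    · change pres (X (Sum.inr 0)) = _
      rw [presentation_X_inr]; simp [ex, D', xmon, Fin.prod_univ_four, X, monomial_mul, monomial_pow]
    · change pres (X (Sum.inr 1)) = _
      rw [presentation_X_inr]; simp [ex, D', xmon, Fin.prod_univ_four, X, monomial_mul, monomial_pow]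
    · change pres (X (Sum.inl (Sum.inl 0))) = _
      rw [presentation_X_inl_inl]; simp [ex, D']; rfl
  -- `ψ` of a monomial is the monomial of the exponent map
  let E : (Fin 5 →₀ ℕ) → (Fin 4 ⊕ PEmpty) →₀ ℕ := fun c =>
    c 4 • Finsupp.single (Sum.inl 0) 1 + (c 0 + c 1 + c 2 + c 3) • Finsupp.single (Sum.inl 1) 1 +
      (c 1 + c 2) • Finsupp.single (Sum.inl 2) 1 + (c 1 + c 3) • Finsupp.single (Sum.inl 3) 1
  have hE : ∀ c : Fin 5 →₀ ℕ, (c.sum fun i n => n • ex i) = E c := by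
    intro c
    rw [Finsupp.sum_fintype _ _ (fun i => by simp), Fin.sum_univ_five]
    simp only [E, ex, Matrix.cons_val_zero, Matrix.cons_val_one, Matrix.cons_val, smul_add, add_smul]
    abel
  have hψmon : ∀ (c : Fin 5 →₀ ℕ) (a : k), pres (χ (monomial c a)) = monomial (E c) a := by
    intro c a
    rw [MvPolynomial.monomial_eq, map_mul, map_mul, MvPolynomial.algHom_C, AlgHom.commutes, MvPolynomial.algebraMap_eq, Finsupp.prod, map_prod, map_prod]
    simp only [map_pow, hψX, monomial_pow, one_pow]
    rw [← hE c, Finsupp.sum, monomial_sum_index]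
  -- `χ g ∈ ker pres`
  have hgker : pres (χ g) = 0 := by
    rw [hg, map_sub, map_mul, map_mul, map_sub, map_mul, map_mul, hψX, hψX, hψX, hψX, monomial_mul, monomial_mul, sub_eq_zero]
    congr 1
    simp only [ex, Matrix.cons_val_zero, Matrix.cons_val_one, Matrix.cons_val]
    abel
  -- the descended map `Φ : k[X]/(g) → Ring`
  let π' : MvPolynomial ((Fin 4 ⊕ PEmpty) ⊕ Fin 3) k →ₐ[k] Ring k PEmpty D' := Ideal.Quotient.mkₐ k _
  have hπ' : ∀ F, π' F = Ideal.Quotient.mk _ F := fun F => rfl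
  have hvan : ∀ a ∈ Ideal.span {g}, (π'.comp χ) a = 0 := by
    intro a ha
    obtain ⟨b, rfl⟩ := Ideal.mem_span_singleton'.mp ha
    rw [AlgHom.comp_apply, map_mul, map_mul, hπ' (χ g), Ideal.Quotient.eq_zero_iff_mem.mpr (show χ g ∈ RingHom.ker pres from hgker), mul_zero]
  let Φ : (MvPolynomial (Fin 5) k ⧸ Ideal.span {g}) →ₐ[k] Ring k PEmpty D' := Ideal.Quotient.liftₐ (Ideal.span {g}) (π'.comp χ) hvan
  have hΦmk : ∀ F, Φ (Ideal.Quotient.mk _ F) = π' (χ F) := fun F => rfl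
  -- surjective: every symbol class is hit (dummies are `1`)
  have hsymb : ∀ σ : (Fin 4 ⊕ PEmpty) ⊕ Fin 3, ∃ F : MvPolynomial (Fin 5) k, π' (χ F) = π' (X σ) := by
    have hit : ∀ i : Fin 5, π' (χ (X i)) = π' (X (sym i)) := fun i => by rw [hχX]
    rintro ((s | p) | j)
    · fin_cases s
      · exact ⟨X 4, hit 4⟩
      · exact ⟨X 0, hit 0⟩
      · refine ⟨1, ?_⟩
        rw [map_one, map_one, eq_comm, hπ', ← (Ideal.Quotient.mk _).map_one, Ideal.Quotient.eq, RingHom.mem_ker, map_sub, map_one,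
          presentation_X_inl_inl]
        simp [D']
      · refine ⟨1, ?_⟩
        rw [map_one, map_one, eq_comm, hπ', ← (Ideal.Quotient.mk _).map_one, Ideal.Quotient.eq, RingHom.mem_ker, map_sub, map_one,
          presentation_X_inl_inl]
        simp [D']
    · exact p.elim
    · fin_cases j
      · exact ⟨X 2, hit 2⟩
      · exact ⟨X 3, hit 3⟩
      · exact ⟨X 1, hit 1⟩
  have hsurj : Function.Surjective Φ := by
    intro y
    obtain ⟨G, rfl⟩ := Ideal.Quotient.mk_surjective y
    change ∃ a, Φ a = π' G
    induction G using MvPolynomial.induction_on with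
    | C c => exact ⟨Ideal.Quotient.mk _ (C c), by rw [hΦmk, MvPolynomial.algHom_C, MvPolynomial.algebraMap_eq]⟩
    | add p q hp hq =>
      obtain ⟨a, ha⟩ := hp
      obtain ⟨b, hb⟩ := hq
      exact ⟨a + b, by rw [map_add, ha, hb, map_add]⟩
    | mul_X p σ hp =>
      obtain ⟨a, ha⟩ := hp
      obtain ⟨F, hF⟩ := hsymb σ
      exact ⟨a * Ideal.Quotient.mk _ F, by rw [map_mul, ha, hΦmk, hF, map_mul]⟩
  -- injective: division by `g` for the lexicographic order, then `ψ` separates the remainder's monomials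
  have hdeg01 : MonomialOrder.lex.degree (X 0 * X 1 : MvPolynomial (Fin 5) k) = Finsupp.single 0 1 + Finsupp.single 1 1 := by
    rw [show (X 0 * X 1 : MvPolynomial (Fin 5) k) = monomial (Finsupp.single 0 1 + Finsupp.single 1 1) 1 by simp [X, monomial_mul],
      MonomialOrder.degree_monomial, if_neg one_ne_zero]
  have hdeg23 : MonomialOrder.lex.degree (X 2 * X 3 : MvPolynomial (Fin 5) k) = Finsupp.single 2 1 + Finsupp.single 3 1 := by
    rw [show (X 2 * X 3 : MvPolynomial (Fin 5) k) = monomial (Finsupp.single 2 1 + Finsupp.single 3 1) 1 by simp [X, monomial_mul],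
      MonomialOrder.degree_monomial, if_neg one_ne_zero]
  have hlt : MonomialOrder.lex.toSyn (MonomialOrder.lex.degree (X 2 * X 3 : MvPolynomial (Fin 5) k)) <
      MonomialOrder.lex.toSyn (MonomialOrder.lex.degree (X 0 * X 1 : MvPolynomial (Fin 5) k)) := by
    rw [hdeg01, hdeg23]
    refine MonomialOrder.lex_lt_iff.mpr (Finsupp.Lex.lt_iff.mpr ⟨0, fun j hj => absurd hj (Fin.not_lt_zero j), ?_⟩)
    simp
  have hdegg : MonomialOrder.lex.degree g = Finsupp.single 0 1 + Finsupp.single 1 1 := by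
    rw [hg, MonomialOrder.degree_sub_of_lt hlt, hdeg01]
  have hlcg : MonomialOrder.lex.leadingCoeff g = 1 := by
    rw [hg, MonomialOrder.leadingCoeff_sub_of_lt hlt,
      show (X 0 * X 1 : MvPolynomial (Fin 5) k) = monomial (Finsupp.single 0 1 + Finsupp.single 1 1) 1 by simp [X, monomial_mul],
      MonomialOrder.leadingCoeff_monomial]
  have hinj : Function.Injective Φ := by
    rw [injective_iff_map_eq_zero]
    intro y hy
    obtain ⟨F, rfl⟩ := Ideal.Quotient.mk_surjective y
    rw [hΦmk, hπ', Ideal.Quotient.eq_zero_iff_mem, RingHom.mem_ker] at hy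
    -- divide
    obtain ⟨q, r, hFqr, -, hr⟩ := MonomialOrder.div_single (m := MonomialOrder.lex) (b := g) (by rw [hlcg]; exact isUnit_one) F
    have hr0 : pres (χ r) = 0 := by
      have := hy
      rw [hFqr, map_add, map_add, map_mul, map_mul, hgker, mul_zero, zero_add] at this
      exact this
    -- the remainder vanishes
    have hrsupp : ∀ c ∈ r.support, c 0 = 0 ∨ c 1 = 0 := by
      intro c hc
      have h := hr c hc
      rw [hdegg] at h
      by_contra hne
      simp only [not_or] at hne
      apply h
      intro i
      fin_cases i <;> simp <;> omega
    have hr_eq : r = 0 := by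
      by_contra hrne
      obtain ⟨c₀, hc₀'⟩ := MvPolynomial.ne_zero_iff.mp hrne
      have hc₀ : c₀ ∈ r.support := MvPolynomial.mem_support_iff.mpr hc₀'
      have hsum : pres (χ r) = ∑ c ∈ r.support, monomial (E c) (r.coeff c) := by
        conv_lhs => rw [r.as_sum]
        rw [map_sum, map_sum]
        exact Finset.sum_congr rfl fun c _ => hψmon c _
      have hcoeff : (pres (χ r)).coeff (E c₀) = r.coeff c₀ := by
        rw [hsum, coeff_sum]
        simp only [coeff_monomial]
        rw [Finset.sum_eq_single c₀]
        · rw [if_pos rfl]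
        · intro c hc hne
          rw [if_neg]
          intro hEq
          exact hne (expMap_injOn c c₀ (hrsupp c hc) (hrsupp c₀ hc₀) hEq)
        · intro h
          exact absurd hc₀ h
      rw [hr0, coeff_zero] at hcoeff
      exact hc₀' hcoeff.symm
    rw [Ideal.Quotient.eq_zero_iff_mem, hFqr, hr_eq, add_zero]
    exact Ideal.mul_mem_left _ _ (Ideal.mem_span_singleton_self g)
  exact ⟨(RingEquiv.ofBijective (Φ : (MvPolynomial (Fin 5) k ⧸ Ideal.span {g}) →+* Ring k PEmpty D') ⟨hinj, hsurj⟩)⟩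

end Summit.ResolutionOfSingularities.ResolutionOfSingularities.Theorems.FInjectiveMacaulayfication.SegreNodeBinomial

end
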